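import Mathlib
import HarnessLib
import Summits.ResolutionOfSingularities.ResolutionOfSingularities.Theorems.WildQuotientsWildQuotientResolutionJordanFiveVertexCover
import Summits.ResolutionOfSingularities.ResolutionOfSingularities.Theorems.WildQuotientsWildQuotientResolutionJordanFiveChartW1Defs

/-!
# RUNG V5 (`J₅`), loci at `W₁`: `HS₁` (the edge surface misses `chartW₁`) and `HA₁` (the `μ₄`-vertex
# curve misses `chartW₁`)
(crux stmt-ResolutionOfSingularities-15640 `WildQuotients.WildQuotientResolution`, line `Sketch`;
chain w45c RUNG V5 `JordanFive.jordanFive_hasResolution_of_bricks` (res-L1-w45c-lead-1 BRICK LIST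
v1 `stubs/J5Bricks.lean` l.115–116: `HS₁ : Disjoint edgeSurface ↑W₁`, `HA₁ : Disjoint (vertexCurve 0)
↑W₁`), res-L1-w45c-plan-1 RULING 10:50Z «stub-5 = (δ1) … + loci HS₁/HA₁/HB₂/HA₂», W₁ TERM =
res-L1-w45c-stub-1's `chartW₁ = D₊(H′²t · T′²H′t²)` (p526168); written by res-D-pv-033 AS
res-L1-w45c-stub-5. [OURS · L1 W4.5c] — Rees-algebra bookkeeping; NOT a statement of any manuscript.)

MECHANISM (the J₄ `HC₀W` pattern, p504476): a point `v` of the fixed locus lying in none of the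
principal charts `V[g_j] = D₊(g_j t)`, `j ∈ J`, has every `g_j t` (`j ∈ J`) in its homogeneous
prime `𝔭_v`; stub-1's certificate `T′²H′ = Σ c_{ij} g_i g_j` (p526168, proof of
`tPrime_sq_mul_hPrime_mem_I12_sq`) uses only products `g₁·g_j` and `g₀·g_j` with
`j ∈ {1,4,6,8,9,10,18,20,35,37}`, so `T′²H′ t² ∈ 𝔭_v` as soon as these ten `g_j t` lie in `𝔭_v`
(`tSqHT2_mem_of_reesT_mem`) — which holds on the edge surface (`j ∉ {0,2,5,13}`) and on the
`μ₄`-vertex curve (`j ≠ 0`). Hence `v ∉ D₊(H′²t · T′²H′t²) = chartW₁`.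
* `JordanFive.reesT_gens12_mem_of_not_mem_chart` — `v ∉ chart j ⇒ g_j t ∈ 𝔭_v`;
* `JordanFive.tSqHT2_eq_reesT_combination`, `JordanFive.tSqHT2_mem_of_reesT_mem` — the certificate;
* **`JordanFive.disjoint_edgeSurface_chartW₁`** = `HS₁` and **`JordanFive.disjoint_vertexCurve_zero_chartW₁`**
  = `HA₁`, VERBATIM at `W₁ := chartW₁ k n a b c d`.
-/

-- single-problem summit: the doubled namespace component `ResolutionOfSingularities` is forced
set_option linter.dupNamespace false

noncomputable section

open CategoryTheory AlgebraicGeometry TopologicalSpace MvPolynomial Polynomial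
open Literature.AlgebraicGeometry.Resolution

namespace Summit.ResolutionOfSingularities.ResolutionOfSingularities.Theorems.WildQuotientResolution.JordanFive

variable (k : Type) [Field k] (n : ℕ) (a b c d : Fin n)

/-! ## Off a principal chart, its generator section lies in the homogeneous prime -/

/-- **`v ∉ chart j ⇒ g_j t ∈ 𝔭_v`** (`chart j = D₊(g_j t)`). [OURS · L1 W4.5c] [folklore] -/
theorem reesT_gens12_mem_of_not_mem_chart (j : Fin 40) (v : affineBlowup (I12 k n a b c d))
    (hv : v ∉ chart k n a b c d j) :
    reesT (gens12 k n a b c d j) (gens12_mem_I12 k n a b c d j) ∈ v.asHomogeneousIdeal := by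
  by_contra h
  exact hv ((chart_eq_basicOpen k n a b c d j).symm ▸ (Proj.mem_basicOpen _ _ _).mpr h)

/-! ## The certificate `T′²H′ t² = (x_b⁴t)·A + (x_a³t)·B` -/

/-- **`T′²H′ t² = (g₁ t)·A + (g₀ t)·B`** in `k[x][I₁₂ t]`, with `A`, `B` explicit `k[x]`-combinations of
the sections `g_j t`, `j ∈ {1,4,5,8,34,35,39}` resp. `{1,4,6,8,9,10,18,20,35,37}` (res-L1-w45c-stub-1's
certificate for `T′²H′ ∈ I₁₂²`, read in the Rees algebra). [OURS · L1 W4.5c] [folklore] -/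
theorem tSqHT2_eq_reesT_combination :
    tSqHT2 k n a b c d =
      reesT (gens12 k n a b c d 1) (gens12_mem_I12 k n a b c d 1) *
        (reesT (gens12 k n a b c d 1) (gens12_mem_I12 k n a b c d 1) +
          (-8 : MvPolynomial (Fin n) k) • reesT (gens12 k n a b c d 8) (gens12_mem_I12 k n a b c d 8) +
          (-1 : MvPolynomial (Fin n) k) • reesT (gens12 k n a b c d 35) (gens12_mem_I12 k n a b c d 35) +
          (21 : MvPolynomial (Fin n) k) • reesT (gens12 k n a b c d 5) (gens12_mem_I12 k n a b c d 5) +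
          (6 : MvPolynomial (Fin n) k) • reesT (gens12 k n a b c d 4) (gens12_mem_I12 k n a b c d 4) +
          (6 : MvPolynomial (Fin n) k) • reesT (gens12 k n a b c d 34) (gens12_mem_I12 k n a b c d 34) +
          (-2 : MvPolynomial (Fin n) k) • reesT (gens12 k n a b c d 39) (gens12_mem_I12 k n a b c d 39)) +
      reesT (gens12 k n a b c d 0) (gens12_mem_I12 k n a b c d 0) *
        ((-18 : MvPolynomial (Fin n) k) • reesT (gens12 k n a b c d 20) (gens12_mem_I12 k n a b c d 20) +
          (-30 : MvPolynomial (Fin n) k) • reesT (gens12 k n a b c d 18) (gens12_mem_I12 k n a b c d 18) +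
          (-9 : MvPolynomial (Fin n) k) • reesT (gens12 k n a b c d 37) (gens12_mem_I12 k n a b c d 37) +
          (-6 * X d + 10 * X c + 2 * X b + X a : MvPolynomial (Fin n) k) •
            reesT (gens12 k n a b c d 1) (gens12_mem_I12 k n a b c d 1) +
          (36 : MvPolynomial (Fin n) k) • reesT (gens12 k n a b c d 10) (gens12_mem_I12 k n a b c d 10) +
          (9 : MvPolynomial (Fin n) k) • reesT (gens12 k n a b c d 9) (gens12_mem_I12 k n a b c d 9) +
          (18 * X d - 12 * X c - 6 * X b - 2 * X a : MvPolynomial (Fin n) k) •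
            reesT (gens12 k n a b c d 8) (gens12_mem_I12 k n a b c d 8) +
          (-6 * X d - X a : MvPolynomial (Fin n) k) •
            reesT (gens12 k n a b c d 35) (gens12_mem_I12 k n a b c d 35) +
          (-18 : MvPolynomial (Fin n) k) • reesT (gens12 k n a b c d 6) (gens12_mem_I12 k n a b c d 6) +
          (-9 * X d + 12 * X c + 6 * X b : MvPolynomial (Fin n) k) •
            reesT (gens12 k n a b c d 4) (gens12_mem_I12 k n a b c d 4)) := by
  apply Subtype.ext
  rw [coe_tSqHT2]
  simp only [Subalgebra.coe_add, Subalgebra.coe_mul, Subalgebra.coe_smul, coe_reesT,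
    Polynomial.smul_monomial, smul_eq_mul, mul_add, Polynomial.monomial_mul_monomial,
    Nat.reduceAdd]
  apply Polynomial.ext
  intro m
  simp only [Polynomial.coeff_add, Polynomial.coeff_monomial]
  split_ifs
  · simp only [gens12, Matrix.cons_val, JordanFour.tPrime, JordanFour.hPrime]
    ring
  · ring

/-- **`T′²H′ t² ∈ 𝔭`** as soon as `g_j t ∈ 𝔭` for `j ∈ {1,4,6,8,9,10,18,20,35,37}` (any ideal `𝔭` of
the Rees algebra). [OURS · L1 W4.5c] [folklore] -/
theorem tSqHT2_mem_of_reesT_mem (𝔭 : Ideal (reesAlgebra (I12 k n a b c d)))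
    (h : ∀ j : Fin 40, j = 1 ∨ j = 4 ∨ j = 6 ∨ j = 8 ∨ j = 9 ∨ j = 10 ∨ j = 18 ∨ j = 20 ∨
      j = 35 ∨ j = 37 → reesT (gens12 k n a b c d j) (gens12_mem_I12 k n a b c d j) ∈ 𝔭) :
    tSqHT2 k n a b c d ∈ 𝔭 := by
  rw [tSqHT2_eq_reesT_combination]
  refine 𝔭.add_mem (𝔭.mul_mem_right _ (h 1 (by decide))) (𝔭.mul_mem_left _ ?_)
  refine 𝔭.add_mem (𝔭.add_mem (𝔭.add_mem (𝔭.add_mem (𝔭.add_mem (𝔭.add_mem (𝔭.add_mem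
    (𝔭.add_mem (𝔭.add_mem (𝔭.smul_of_tower_mem _ (h 20 (by decide)))
    (𝔭.smul_of_tower_mem _ (h 18 (by decide)))) (𝔭.smul_of_tower_mem _ (h 37 (by decide))))
    (𝔭.smul_of_tower_mem _ (h 1 (by decide)))) (𝔭.smul_of_tower_mem _ (h 10 (by decide))))
    (𝔭.smul_of_tower_mem _ (h 9 (by decide)))) (𝔭.smul_of_tower_mem _ (h 8 (by decide))))
    (𝔭.smul_of_tower_mem _ (h 35 (by decide)))) (𝔭.smul_of_tower_mem _ (h 6 (by decide))))
    (𝔭.smul_of_tower_mem _ (h 4 (by decide)))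

/-- If `T′²H′ t² ∈ 𝔭_v` then `v ∉ chartW₁ = D₊(H′²t · T′²H′t²)`. [OURS · L1 W4.5c] [folklore] -/
theorem not_mem_chartW₁_of_tSqHT2_mem (v : affineBlowup (I12 k n a b c d))
    (hv : tSqHT2 k n a b c d ∈ v.asHomogeneousIdeal.toIdeal) : v ∉ chartW₁ k n a b c d := by
  intro h
  rw [chartW₁_def] at h
  exact (Proj.mem_basicOpen _ _ _).mp h (v.asHomogeneousIdeal.toIdeal.mul_mem_left _ hv)

/-! ## `HS₁` and `HA₁` -/

/-- **Brick `HS₁` of the J₅ toric exit** (`stubs/J5Bricks.lean` l.115 VERBATIM at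
`W₁ := chartW₁ k n a b c d`): the edge surface `S_ac = Fix ∖ ⋃_{j ∉ {0,2,5,13}} V[g_j]` misses
`chartW₁` — off those charts the ten sections of the certificate lie in `𝔭_v`, hence so does
`T′²H′ t²`. [OURS · L1 W4.5c] [folklore] -/
theorem disjoint_edgeSurface_chartW₁ :
    Disjoint (edgeSurface k n a b c d) (chartW₁ k n a b c d : Set (affineBlowup (I12 k n a b c d))) := by
  rw [Set.disjoint_left]
  rintro v ⟨-, hv⟩ hvW
  refine not_mem_chartW₁_of_tSqHT2_mem k n a b c d v
    (tSqHT2_mem_of_reesT_mem k n a b c d _ fun j hj => ?_) hvW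
  have hj' : j ≠ 0 ∧ j ≠ 2 ∧ j ≠ 5 ∧ j ≠ 13 := by
    rcases hj with rfl | rfl | rfl | rfl | rfl | rfl | rfl | rfl | rfl | rfl <;> decide
  refine reesT_gens12_mem_of_not_mem_chart k n a b c d j v fun h => hv ?_
  exact Opens.mem_iSup.mpr ⟨⟨j, hj'⟩, h⟩

/-- **Brick `HA₁` of the J₅ toric exit** (`stubs/J5Bricks.lean` l.116 VERBATIM at
`W₁ := chartW₁ k n a b c d`): the `μ₄`-vertex curve `C_a = Fix ∖ ⋃_{j ≠ 0} V[g_j]` misses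
`chartW₁` (off the charts `j ≠ 0` the ten sections lie in `𝔭_v`). [OURS · L1 W4.5c] [folklore] -/
theorem disjoint_vertexCurve_zero_chartW₁ :
    Disjoint (vertexCurve k n a b c d 0)
      (chartW₁ k n a b c d : Set (affineBlowup (I12 k n a b c d))) := by
  rw [Set.disjoint_left]
  rintro v ⟨-, hv⟩ hvW
  refine not_mem_chartW₁_of_tSqHT2_mem k n a b c d v
    (tSqHT2_mem_of_reesT_mem k n a b c d _ fun j hj => ?_) hvW
  have hj' : j ≠ 0 := by
    rcases hj with rfl | rfl | rfl | rfl | rfl | rfl | rfl | rfl | rfl | rfl <;> decide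
  refine reesT_gens12_mem_of_not_mem_chart k n a b c d j v fun h => hv ?_
  exact Opens.mem_iSup.mpr ⟨⟨j, hj'⟩, h⟩

end Summit.ResolutionOfSingularities.ResolutionOfSingularities.Theorems.WildQuotientResolution.JordanFive

end
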